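import Mathlib
import Literature.MathematicalPhysics.QuantumFieldTheory.Balaban1983to89.B8Eq127LandauGauge
import Literature.MathematicalPhysics.QuantumFieldTheory.Balaban1983to89.B6Eq295
import Literature.MathematicalPhysics.QuantumFieldTheory.Balaban1983to89.B8SectEStatements

/-!
# `Balaban1983to89.B8Eq191Hprime` — T. Bałaban, *Spaces of regular gauge field configurations on a lattice and gauge
# fixing conditions*, Commun. Math. Phys. **99** (1985) 75–102 [Balaban1985RegularSpaces], (1.91) p. 91: the operators
# «H′ = G′²Q′\*(Q′G′²Q′\*)⁻¹, G′ = (Δ + Q′\*aQ′)⁻¹» as DEFINITIONS WITH BODIES — over the (3.23)–(3.25) data of [4] and on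
# finite lattice carriers for EVERY background field — with «Q′H′ = I» (p. 96) PROVED, the variational characterisation
# of H′X (the covariant form of [B6] (2.101)–(2.102)), the link to the projection R of [4] (3.25), and the kernel form of p. 92

statement-level skeleton of published theorems with citation tags; proofs where landed; nothing here is a claim about the Yang–Mills mass gap

PDF held: `paper:balaban1985-cmp99-regular-spaces-gauge-fixing` (journal page = PDF page + 74).  Pages read for this
module: p. 91 [PDF 17] AS AN IMAGE (render `run/shared/lean/pub/pub-balaban/b2b-balaban-ref1/pages/
1985-cmp99-regular-spaces-gauge-fixing-p017-x2.png`), pp. 92, 95–96 [PDF 18, 21–22] from the `lit read` text layer and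
the cell's earlier image reads (rows B8.Eq1.91, B8.Eq1.113 of `run/shared/lean/pub/lit-balaban/lit-balaban-r05/ROWS-B8.md`,
module `B8Ineq192`); [4] = T. Bałaban, *Propagators for lattice gauge theories in a background field*, CMP **99** (1985)
389–434 [Balaban1985BackgroundPropagators] pp. 394, 416 through the tree modules `B9Eq325Proj`, `B9Thm311Data`,
`B9Thm311Lattice`; [B6] = T. Bałaban, *Propagators and renormalization transformations for lattice gauge theories. II*,
CMP **96** (1984) 223–250 [Balaban1984PropagatorsII] pp. 240–242 through the tree module `B6Eq295`; [B5] = part I, CMP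
**95** (1984) 17–40 [Balaban1984PropagatorsI] p. 25 through `B9Thm311Data`.

CITATION HEADER (lean-in-tree rule).  Cell `lit-balaban`, unit `lit-balaban-r05` gen 10 (B8 fold owner); WHAT IS
REPRODUCED = SKELETON row **B8.Eq1.91** (DEF row (1.91)–(1.92), hitherto «typed-existing»: the inequality (1.92) is
kernel-checked from the leaves of [4] in `B8Ineq192`, with H′ present only through the KERNEL DICTIONARY `HDominated`, and
the algebra of H′, G′, R only as ring elements in `B8.landau_projection_identities`) — this module gives the DEFINITION
(1.91) a body, and serves the OPERATOR half of the interface need I-B8-2 of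
`run/shared/lean/pub/lit-balaban/lit-balaban-r05/INTERFACES-B8.md` («G′ = (Δ + Q′\*aQ′)⁻¹, H′ = G′²Q′\*(Q′G′²Q′\*)⁻¹ (1.91)
as concrete operators …»; the BOUNDS half — Theorems 3.1–3.3/(3.47)–(3.49) of [4] — is untouched).  It also DISCHARGES,
on these carriers, the hypothesis `hQH : Q′H′ = I` under which the abstract Sect. E algebra `B8SectEStatements.eq1114`
((1.114) ⇐ (1.115)–(1.117)) was proved (interface E-B8-14: «instantiation waits on I-B8-2 (H′)»).  Kind «definition +
kernel-checked dictionary»; no `… : Prop` fact is introduced; 0 sorry.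

WHAT IS PRINTED (verbatim).
* p. 91 [PDF 17], after (1.90): *"The function Q′(u₁, λ) is almost equal to Q′λ, the linear averaging operator used in the
  definition of the operator R, the error is of second order in α₃, α₄. If it was equal to Q′λ, then D\*Dλ = Δλ would
  belong to the subspace R = ΔN(Q′) and we would have Rg(i ad_λ)Δλ = RΔλ + O(α₄)Δλ = (Δ + Q′\*aQ′)λ + O(α₄)Δλ. … We
  want to find a transformation of variables λ which linearizes the function Q′(u₁, λ), more exactly transforms it into
  the function Q′λ. … Of course such a problem is highly indeterminate because a number of variables involved is much
  bigger than a number of conditions. In the next section we will find one solution of this problem. Let us introduce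
  the operators H′ = G′²Q′\*(Q′G′²Q′\*)⁻¹, G′ = (Δ + Q′\*aQ′)⁻¹. (1.91) They were investigated in [4], and the following
  inequality can be obtained from the results of this paper: |(H′X)(x)|, |(∇H′X)(x)| ≦ B′₀[1, (L^jη)⁻¹]|X| for x ∈ Ω_j,
  (1.92)"*; p. 92 [PDF 18]: *"where (H′X)(x) = Σ_{y′∈𝔅_k}(L^{j′}η)^d H′(x, y′)X(y′), and B′₀ is an absolute constant
  (depending on d and L only)."*
* p. 95 [PDF 21]: *"We want to construct a function D′(λ) for α₃, α₄ sufficiently small, whose values are configurations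
  X : 𝔅_k → 𝔤, such that the transformation λ′ = λ − H′D′(λ) (1.113) changes the function Q′(λ′) into the linear function
  Q′λ: Q′(λ − H′D′(λ)) = Q′λ. (1.114)"*; p. 96 [PDF 22]: *"Using the equality (213) [3] the above equation can be written
  in the following form: Q′λ − Q′H′D′(λ) + C′(λ − H′D′(λ)) = Q′λ, (1.115) hence −D′(λ) + C′(λ − H′D′(λ)) = 0. (1.116)"* —
  the step (1.115) ⇒ (1.116) IS «Q′H′ = I».
* [4] p. 394 [PDF 6]: *"Let us introduce the operator Δ′_a = Δ′_a(U) = (Δ^η_U + Q′\*aQ′)↾_{Ω₀} … (3.24) … Its inverse is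
  denoted by G′, or G′(U). … Rf = (I − G′Q′\*(Q′G′²Q′\*)^{−1}Q′G′)f, (3.25) where G′ = G′(U) = (Δ′_a)^{−1}. We do not know
  yet if the operators in the above formula are well defined."*; p. 416, Theorem 3.11: *"the operators Δ′_a, G′,
  (Q′G′²Q′\*)^{−1}, Δ_a, G are positive definite. This is obvious for the first three operators"* — typed/proved in
  `B9Eq325Proj` (`lapA`, `R325`, `Data`), `B9Thm311Data` (`gOf`, `cOf`, `data_of_posDef`), `B9Thm311Lattice`
  (`obvious_311_lattice` on the ℓ² carriers, every background).
* [B6] p. 241 [PDF 19]: *"hence λ = Δ⁻²Q′_j\*(Q′_jΔ⁻²Q′_j\*)⁻¹μ, μ = Q′_jλ. (2.101) … It gives a solution of the variational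
  problem inf_{λ′ : Q′_jλ′ = μ} ½‖Δλ′‖². (2.102) Let us denote the operator in (2.101) by H′_j, so λ = H′_jμ."*, *"where the
  equality Q′_jλ = Q′_jH′_jμ = μ was used"*; p. 242 [PDF 20]: *"Δ′_j = H′_j\*Δ²H′_j. (2.107)"* — abstract theorems
  `B6Eq295.comp_hPrime_eq_id`, `hPrime_minimises`, `norm_lap_sq_eq_add` (r03), used here BY NAME at (Δ, Δ⁻¹) := (Δ′_a, G′).

WHAT THIS MODULE DOES (all statements PROVED; the two papers' objects are related BY NAME, nothing is restated).
§1 ABSTRACT, over the (3.25)-data `B9Eq325Proj.Data Δ q qs A g c` of [4] (E ⊇ L²(Ω₀, 𝔤), F = L²(𝔅_k) real inner-product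
   spaces; Δ = Δ^η_{U₀}, q = Q′(U₀), qs = Q′\*, A = a, g = G′ = (Δ′_a)⁻¹, c = (Q′G′²Q′\*)⁻¹):
   * `Hp qs g c := g ∘ g ∘ qs ∘ c` — **(1.91)** H′ = G′²Q′\*(Q′G′²Q′\*)⁻¹ : F → E, with `Hp_eq_hOp` (= [B6]'s `GQ*E` pattern
     `B6SectA.hOp (G′∘G′) Q′\* (Q′G′²Q′\*)⁻¹`, definitionally) and `Hp_indep` (CANONICAL: G′, (Q′G′²Q′\*)⁻¹ are unique given
     (Δ, Q′, a), so (1.91) names one operator);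
   * **`q_Hp` / `q_comp_Hp`: «Q′H′ = I»** (p. 96), hence `Hp_injective`, `q_sub_Hp_q` (λ − H′Q′λ ∈ N(Q′)), `Hp_q_Hp_q`
     (H′Q′ idempotent), **`isCompl_range_Hp_ker_q`: L²(Ω₀, 𝔤) = Ran H′ ⊕ N(Q′(U₀))** — the (1.113) change of variables
     λ ↦ λ − H′X moves along a complement of the constraint space (p. 91's "highly indeterminate … one solution");
   * `lapA_Hp`, `lapA_lapA_Hp` (Euler–Lagrange: Δ′_a²H′X = Q′\*(Q′G′²Q′\*)⁻¹X ∈ Ran Q′\*, the covariant (2.99)–(2.100)),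
     `inner_lapA_Hp_lapA_eq_zero` (Ran H′ ⟂ N(Q′) for ⟨Δ′_a·, Δ′_a·⟩), **`norm_lapA_Hp_sq_le`: H′X SOLVES
     inf {½‖Δ′_aλ‖² : Q′λ = X}** (the covariant-background form of (2.102)), `norm_lapA_sq_eq_add` (Pythagoras),
     **`eq_Hp_of_isMin` / `existsUnique_minimiser`** (the minimiser is unique and IS H′X — no zero mode here, Δ′_a being
     invertible), `inner_lapA_Hp_lapA_Hp` / `norm_lapA_Hp_sq` (H′\*Δ′_a²H′ = (Q′G′²Q′\*)⁻¹, the covariant (2.107));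
   * **(1.91) versus (3.25)**: `g_R325` / `lam0_eq` (G′R = G′ − H′Q′G′: the (3.22)-minimiser λ₀ = G′Rf of [4] is G′f − H′(Q′G′f)),
     `sub_R325_eq_lapA_Hp` (f − Rf = Δ′_aH′(Q′G′f)), and the p. 91 sentence `R325_lap_eq_lapA` (λ ∈ N(Q′) ⇒ Δλ ∈ ΔN(Q′) and
     RΔλ = Δλ = (Δ + Q′\*aQ′)λ).
§2 LATTICE (the ℓ² carriers of `B9Thm311Lattice`: finite site set `X` ⊇ Ω₀, block centres `Y` = 𝔅_k, fibre `V` = 𝔤 with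
   its real scalar product, transports `τ x x' = R(U₀(⟨x, x'⟩))`, bond weights, block system (3.19), averaging weights a):
   **`gL`, `cL`, `HpL` — G′(U₀), (Q′G′²Q′\*)⁻¹(U₀), H′(U₀) of (1.91) WITH BODIES for EVERY background with injective
   transports** (conjugations are), positive weights and every block system with the printed structural properties (via
   `B9Thm311Data.gOf`/`cOf` at `B9Thm311Lattice.lapA_lattice_posDef`); `data_L` (they ARE (3.25)-data), `gL_lapA`,
   `gL_cL_posDef` (Theorem 3.11's "obvious" clause for them), **`qL_HpL` («Q′H′ = I» on the lattice)**, `HpL_isMin` /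
   `HpL_minimises` (the variational characterisation), `lam0_L` (λ₀ = G′f − H′Q′G′f and R = THE orthogonal projection onto
   Δ^η_{U₀}N(Q′(U₀))), and **`eq1114_L`: (1.114) ⇐ (1.117) for the lattice H′(U₀) with `hQH` DISCHARGED** (the abstract
   `B8SectEStatements.eq1114` instantiated at Q := `qL`, H′ := `HpL`).
§3 KERNEL FORM (p. 92): `kernelOf T x y'` (H′(x, y′) : 𝔤 →ₗ 𝔤) and `apply_eq_sum_kernelOf`: (TX)(x) = Σ_{y′} T(x, y′)X(y′) for
   every linear map of the finite carriers — the shape of the printed «(H′X)(x) = Σ_{y′∈𝔅_k}(L^{j′}η)^d H′(x, y′)X(y′)».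

HONEST SCOPE.  (i) (1.92) and "They were investigated in [4]" = the BOUNDS on H′: not here — `B8Ineq192` derives (1.92)
from Theorems 3.1–3.2 of [4] as named leaves; nothing in this file is a bound.  (ii) Weights: [4] weights the scalar
products by η^d and a_j(L^jη)^{d−2}, and p. 92 the coarse sum by (L^{j′}η)^d; the carriers of `B9Thm311Lattice` use the
unweighted ℓ² of `PiLp 2` with the weights absorbed into c_b, a_c, w (cell DIVERGENCE D-b09.24) — (1.91), «Q′H′ = I» and
the variational statements are then LITERAL for the absorbed operators; the printed normalisation is not asserted.  (iii)
Δ = [4]'s D†D with Dirichlet conditions as modelled by the bond set of `lapL`; Ω₀, 𝔅_k, Λ_j enter only through X, Y and the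
block system (as in `B8Eq127LandauGauge`).  (iv) [B6] (2.101)–(2.102)/(2.107) are statements about the FLAT Δ⁻²-operator
H′_j; this file proves their covariant-background ANALOGUES for (1.91) by the same abstract algebra (`B6Eq295`) — the
analogy is ours, flagged as such in each docstring; B8 itself prints only (1.91)–(1.92) and uses Q′H′ = I.  (v) B8's own
sup-normed ℤᵈ/𝔸 carriers (p05's `B8Eq1117Concrete.XSpace`, r05's `B8Eq1119LambdaSpace.lamSub`, where H′ is an abstract CLM
`Hc` with ‖H′‖ ≤ B′₀) are NOT bridged to the ℓ² carriers here (that needs (1.92), i.e. (i)).  Value = a definition with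
body + kernel-checked dictionary for a DEF row; NOT summit progress.
-/

namespace Literature.MathematicalPhysics.QuantumFieldTheory.Balaban1983to89.B8Eq191Hprime

open B5Projector144 B9Eq325Proj B9Thm311Data B9Thm311Lattice
open scoped InnerProductSpace

noncomputable section

/-! ## §1  Abstract: the operator H′ of (1.91) over the (3.25)-data of [4] -/

section Abstract

variable {E F : Type*} [NormedAddCommGroup E] [InnerProductSpace ℝ E] [NormedAddCommGroup F]
  [InnerProductSpace ℝ F]

section Defs

variable (qs : F →ₗ[ℝ] E) (g : E →ₗ[ℝ] E) (c : F →ₗ[ℝ] F)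

/-- **(1.91)** H′ = G′²Q′\*(Q′G′²Q′\*)⁻¹ : L²(𝔅_k) → L²(Ω₀, 𝔤), in the letters of `B9Eq325Proj` (g = G′ = (Δ + Q′\*aQ′)⁻¹,
qs = Q′\*, c = (Q′G′²Q′\*)⁻¹). [cite: Balaban1985RegularSpaces, (1.91) p.91] -/
def Hp : F →ₗ[ℝ] E := g ∘ₗ g ∘ₗ qs ∘ₗ c

/-- unfolding of (1.91): H′X = G′(G′(Q′\*((Q′G′²Q′\*)⁻¹X))). [cite: Balaban1985RegularSpaces, (1.91) p.91] -/
theorem Hp_apply (X : F) : Hp qs g c X = g (g (qs (c X))) := rfl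

/-- (1.91) is the `GQ*E` pattern of [B6] (2.35)/(2.101) with G = G′² (`B6SectA.hOp`): H′ = hOp (G′∘G′) Q′\* (Q′G′²Q′\*)⁻¹ —
the covariant-background version of [B6]'s H′_j = Δ⁻²Q′_j\*(Q′_jΔ⁻²Q′_j\*)⁻¹ (2.101).
[cite: Balaban1985RegularSpaces, (1.91) p.91; Balaban1984PropagatorsII, (2.101) p.241] -/
theorem Hp_eq_hOp : Hp qs g c = B6SectA.hOp (g ∘ₗ g) qs c := rfl

end Defs

variable {Δ : E →ₗ[ℝ] E} {q : E →ₗ[ℝ] F} {qs : F →ₗ[ℝ] E} {A : F →ₗ[ℝ] F} {g : E →ₗ[ℝ] E} {c : F →ₗ[ℝ] F}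

/-- **«Q′H′ = I»** (p. 96, the step (1.115) ⇒ (1.116); the hypothesis `hQH` of `B8SectEStatements.eq1114`), for the
operator DEFINED by (1.91) over the printed inputs of [4] (3.23)–(3.25). [cite: Balaban1985RegularSpaces, (1.115)–(1.116) p.96, (1.91) p.91] -/
theorem q_Hp (h : Data Δ q qs A g c) (X : F) : q (Hp qs g c X) = X := h.c_right X

/-- «Q′H′ = I» as an identity of operators. [cite: Balaban1985RegularSpaces, (1.115)–(1.116) p.96] -/
theorem q_comp_Hp (h : Data Δ q qs A g c) : q ∘ₗ Hp qs g c = LinearMap.id :=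
  LinearMap.ext fun X => q_Hp h X

/-- H′ is injective (it has the left inverse Q′). [cite: Balaban1985RegularSpaces, (1.91) p.91] -/
theorem Hp_injective (h : Data Δ q qs A g c) : Function.Injective (Hp qs g c) := by
  intro X Y hXY
  have h1 := congrArg q hXY
  rwa [q_Hp h, q_Hp h] at h1

/-- λ − H′Q′λ ∈ N(Q′): subtracting H′ of the average kills the average (the mechanism of the change of variables
λ ↦ λ − H′X of p. 92/(1.113)). [cite: Balaban1985RegularSpaces, (1.113)–(1.114) p.95] -/
theorem q_sub_Hp_q (h : Data Δ q qs A g c) (l : E) : q (l - Hp qs g c (q l)) = 0 := by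
  rw [map_sub, q_Hp h, sub_self]

/-- H′Q′ is idempotent (a projection of L²(Ω₀, 𝔤) onto Ran H′ along N(Q′)). [cite: Balaban1985RegularSpaces, (1.91) p.91] -/
theorem Hp_q_Hp_q (h : Data Δ q qs A g c) (l : E) :
    Hp qs g c (q (Hp qs g c (q l))) = Hp qs g c (q l) := by
  rw [q_Hp h]

/-- Δ′_a H′X = G′Q′\*(Q′G′²Q′\*)⁻¹X. [cite: Balaban1985RegularSpaces, (1.91) p.91] -/
theorem lapA_Hp (h : Data Δ q qs A g c) (X : F) : lapA Δ q qs A (Hp qs g c X) = g (qs (c X)) := by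
  rw [Hp_apply, h.g_right]

/-- The EULER–LAGRANGE identity of the variational problem below: Δ′_a²H′X = Q′\*((Q′G′²Q′\*)⁻¹X) ∈ Ran Q′\* (the
covariant form of [B6] (2.99)–(2.100) «Δλ = P_jΔλ», i.e. Δ²λ ∈ Ran Q′_j\*). [cite: Balaban1984PropagatorsII, (2.99)–(2.101) pp.240–241; Balaban1985RegularSpaces, (1.91) p.91] -/
theorem lapA_lapA_Hp (h : Data Δ q qs A g c) (X : F) :
    lapA Δ q qs A (lapA Δ q qs A (Hp qs g c X)) = qs (c X) := by
  rw [lapA_Hp h, h.g_right]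

/-- **(1.91) versus (3.25) of [4]**: G′R = G′ − H′Q′G′, i.e. the minimiser λ₀ = G′Rf of [4] (3.22) (`B9Eq325Proj.lam0`) is
G′f corrected by H′ of its average: λ₀ = G′f − H′(Q′G′f). [cite: Balaban1985RegularSpaces, (1.91) p.91; Balaban1985BackgroundPropagators, (3.22)+(3.25) p.394] -/
theorem g_R325 (f : E) : g (R325 q qs g c f) = g f - Hp qs g c (q (g f)) := by
  rw [R325_apply, map_sub, Hp_apply]

/-- the same for `lam0`: λ₀(f) = G′f − H′Q′G′f. [cite: Balaban1985BackgroundPropagators, (3.22) p.394; Balaban1985RegularSpaces, (1.91) p.91] -/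
theorem lam0_eq (f : E) : lam0 q qs g c f = g f - Hp qs g c (q (g f)) := by
  rw [lam0_apply, g_R325]

/-- f − Rf = Δ′_a H′(Q′G′f): the part of f removed by the projection R of (3.25) is Δ′_a of an H′-image.
[cite: Balaban1985BackgroundPropagators, (3.25) p.394; Balaban1985RegularSpaces, (1.91) p.91] -/
theorem sub_R325_eq_lapA_Hp (h : Data Δ q qs A g c) (f : E) :
    f - R325 q qs g c f = lapA Δ q qs A (Hp qs g c (q (g f))) := by
  rw [R325_apply, sub_sub_cancel, lapA_Hp h]

/-- p. 91: *"If it was equal to Q′λ, then D\*Dλ = Δλ would belong to the subspace R = ΔN(Q′) and we would have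
… RΔλ … = (Δ + Q′\*aQ′)λ …"* — for λ ∈ N(Q′): Δλ ∈ ΔN(Q′) and RΔλ = Δλ = (Δ + Q′\*aQ′)λ = Δ′_aλ.
[cite: Balaban1985RegularSpaces, p.91 (before (1.91))] -/
theorem R325_lap_eq_lapA (h : Data Δ q qs A g c) (l : E) (hl : q l = 0) :
    Δ l ∈ lapKer Δ q ∧ R325 q qs g c (Δ l) = lapA Δ q qs A l := by
  refine ⟨(mem_lapKer Δ q _).mpr ⟨l, hl, rfl⟩, ?_⟩
  rw [h.R325_lap l hl, lapA_eq_of_ker Δ q qs A l hl]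

/-- L²(Ω₀, 𝔤) = Ran H′ ⊕ N(Q′), part 1: Ran H′ ∩ N(Q′) = 0 (p. 91: the linearisation problem *"is highly indeterminate
because a number of variables involved is much bigger than a number of conditions"* — H′ picks ONE section of Q′).
[cite: Balaban1985RegularSpaces, p.91 (before (1.91)), (1.91) p.91] -/
theorem range_Hp_inf_ker_q (h : Data Δ q qs A g c) :
    LinearMap.range (Hp qs g c) ⊓ LinearMap.ker q = ⊥ := by
  rw [eq_bot_iff]
  intro l hl
  obtain ⟨⟨X, rfl⟩, hker⟩ := Submodule.mem_inf.mp hl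
  rw [LinearMap.mem_ker, q_Hp h] at hker
  rw [hker, map_zero]
  exact Submodule.zero_mem _

/-- L²(Ω₀, 𝔤) = Ran H′ ⊕ N(Q′), part 2: Ran H′ + N(Q′) = everything (λ = H′Q′λ + (λ − H′Q′λ)).
[cite: Balaban1985RegularSpaces, p.91 (before (1.91)), (1.91) p.91] -/
theorem range_Hp_sup_ker_q (h : Data Δ q qs A g c) :
    LinearMap.range (Hp qs g c) ⊔ LinearMap.ker q = ⊤ := by
  rw [eq_top_iff]
  intro l _
  rw [Submodule.mem_sup]
  exact ⟨Hp qs g c (q l), ⟨q l, rfl⟩, l - Hp qs g c (q l), (LinearMap.mem_ker).mpr (q_sub_Hp_q h l),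
    add_sub_cancel _ _⟩

/-- **L²(Ω₀, 𝔤) = Ran H′ ⊕ N(Q′)**: the range of the (1.91) operator is a complement of N(Q′(U₀)) — the change of
variables λ ↦ λ − H′X of (1.113) moves transversally to the constraint space. [cite: Balaban1985RegularSpaces, (1.91) p.91, (1.113) p.95] -/
theorem isCompl_range_Hp_ker_q (h : Data Δ q qs A g c) :
    IsCompl (LinearMap.range (Hp qs g c)) (LinearMap.ker q) :=
  ⟨disjoint_iff.mpr (range_Hp_inf_ker_q h), codisjoint_iff.mpr (range_Hp_sup_ker_q h)⟩

/-- Ran H′ is Δ′_a²-ORTHOGONAL to N(Q′): ⟨Δ′_a H′X, Δ′_aν⟩ = 0 whenever Q′ν = 0 (the orthogonality behind (2.102)/(2.106)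
of [B6]). [cite: Balaban1984PropagatorsII, (2.102) p.241, (2.106) p.242; Balaban1985RegularSpaces, (1.91) p.91] -/
theorem inner_lapA_Hp_lapA_eq_zero (h : Data Δ q qs A g c) (X : F) (ν : E) (hν : q ν = 0) :
    ⟪lapA Δ q qs A (Hp qs g c X), lapA Δ q qs A ν⟫_ℝ = 0 := by
  rw [lapA_Hp h, h.g_symm, h.g_left, adj_symm h.adj, hν, inner_zero_right]

/-! ### The variational characterisation ([B6] (2.101)–(2.102) in the covariant background) -/

/-- plumbing: Δ′_aG′ = I as an operator identity (the `hinv` shape of `B6Eq295`). [folklore] -/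
private theorem lapA_comp_g (h : Data Δ q qs A g c) : lapA Δ q qs A ∘ₗ g = LinearMap.id :=
  LinearMap.ext fun x => h.g_right x

/-- plumbing: (Q′G′²Q′\*)(Q′G′²Q′\*)⁻¹ = I as an operator identity (the `hE` shape of `B6Eq295`). [folklore] -/
private theorem qggqs_comp_c (h : Data Δ q qs A g c) : (q ∘ₗ (g ∘ₗ g) ∘ₗ qs) ∘ₗ c = LinearMap.id :=
  LinearMap.ext fun φ => h.c_right φ

/-- **H′X SOLVES THE VARIATIONAL PROBLEM inf {½‖Δ′_aλ‖² : Q′λ = X}** — the covariant-background form of [B6] p. 241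
*"It gives a solution of the variational problem inf_{λ′: Q′_jλ′ = μ} ½‖Δλ′‖²"* ((2.102), there with Δ⁻² in place of
G′² = (Δ + Q′\*aQ′)⁻²): every λ with Q′λ = X has ‖Δ′_a H′X‖² ≤ ‖Δ′_aλ‖² (and Q′H′X = X, `q_Hp`).  From
`B6Eq295.hPrime_minimises` BY NAME at (Δ, Δ⁻¹) := (Δ′_a, G′).
[cite: Balaban1984PropagatorsII, (2.101)–(2.102) p.241; Balaban1985RegularSpaces, (1.91) p.91] -/
theorem norm_lapA_Hp_sq_le (h : Data Δ q qs A g c) (X : F) (l : E) (hl : q l = X) :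
    ‖lapA Δ q qs A (Hp qs g c X)‖ ^ 2 ≤ ‖lapA Δ q qs A l‖ ^ 2 := by
  rw [Hp_eq_hOp]
  exact B6Eq295.hPrime_minimises (lapA Δ q qs A) g q qs c h.lapA_symm (adj_symm h.adj) (lapA_comp_g h)
    (qggqs_comp_c h) X l hl

/-- Pythagoras behind the minimisation: ‖Δ′_aλ‖² = ‖Δ′_a H′X‖² + ‖Δ′_a(λ − H′X)‖² for Q′λ = X (the translation
λ′ → λ′ + H′_jω of [B6] (2.106): no cross term). [cite: Balaban1984PropagatorsII, (2.102) p.241, (2.106) p.242] -/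
theorem norm_lapA_sq_eq_add (h : Data Δ q qs A g c) (X : F) (l : E) (hl : q l = X) :
    ‖lapA Δ q qs A l‖ ^ 2 =
      ‖lapA Δ q qs A (Hp qs g c X)‖ ^ 2 + ‖lapA Δ q qs A (l - Hp qs g c X)‖ ^ 2 := by
  have hl' : q l = q (B6SectA.hOp (g ∘ₗ g) qs c X) := by
    rw [← Hp_eq_hOp, q_Hp h, hl]
  have h1 := B6Eq295.norm_lap_sq_eq_add (lapA Δ q qs A) g q qs c h.lapA_symm (adj_symm h.adj) (lapA_comp_g h)
    X l hl'
  rwa [← Hp_eq_hOp] at h1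

/-- UNIQUENESS of the minimiser: a competitor λ with Q′λ = X and ‖Δ′_aλ‖² ≤ ‖Δ′_a H′X‖² IS H′X (Δ′_a is invertible —
no zero mode in the covariant Dirichlet setting, unlike the torus Δ of [B6] where λ ⊥ constants is imposed).
[cite: Balaban1984PropagatorsII, (2.101)–(2.102) p.241; Balaban1985RegularSpaces, (1.91) p.91] -/
theorem eq_Hp_of_isMin (h : Data Δ q qs A g c) (X : F) (l : E) (hl : q l = X)
    (hmin : ‖lapA Δ q qs A l‖ ^ 2 ≤ ‖lapA Δ q qs A (Hp qs g c X)‖ ^ 2) : l = Hp qs g c X := by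
  have hsplit := norm_lapA_sq_eq_add h X l hl
  have h0 : ‖lapA Δ q qs A (l - Hp qs g c X)‖ ^ 2 = 0 :=
    le_antisymm (by linarith [sq_nonneg ‖lapA Δ q qs A (Hp qs g c X)‖]) (sq_nonneg _)
  have h1 : lapA Δ q qs A (l - Hp qs g c X) = 0 := by
    rwa [sq_eq_zero_iff, norm_eq_zero] at h0
  have h2 : l - Hp qs g c X = 0 := by
    have h3 := congrArg g h1
    rwa [h.g_left, map_zero] at h3
  exact sub_eq_zero.mp h2

/-- The variational problem has EXACTLY ONE solution, H′X. [cite: Balaban1984PropagatorsII, (2.101)–(2.102) p.241; Balaban1985RegularSpaces, (1.91) p.91] -/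
theorem existsUnique_minimiser (h : Data Δ q qs A g c) (X : F) :
    ∃! l : E, q l = X ∧ ∀ l' : E, q l' = X → ‖lapA Δ q qs A l‖ ^ 2 ≤ ‖lapA Δ q qs A l'‖ ^ 2 :=
  ⟨Hp qs g c X, ⟨q_Hp h X, fun l' hl' => norm_lapA_Hp_sq_le h X l' hl'⟩,
    fun l hl => eq_Hp_of_isMin h X l hl.1 (hl.2 _ (q_Hp h X))⟩

/-- The minimum VALUE as a quadratic form: ⟨Δ′_a H′X, Δ′_a H′Y⟩ = ⟨(Q′G′²Q′\*)⁻¹X, Y⟩ — i.e. H′\*Δ′_a²H′ =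
(Q′G′²Q′\*)⁻¹, the covariant form of [B6] (2.107) «Δ′_j = H′_j\*Δ²H′_j» ((2.108): Δ′_j = (Q′_jΔ⁻²Q′_j\*)⁻¹).
[cite: Balaban1984PropagatorsII, (2.107) p.242; Balaban1985RegularSpaces, (1.91) p.91] -/
theorem inner_lapA_Hp_lapA_Hp (h : Data Δ q qs A g c) (X Y : F) :
    ⟪lapA Δ q qs A (Hp qs g c X), lapA Δ q qs A (Hp qs g c Y)⟫_ℝ = ⟪c X, Y⟫_ℝ := by
  rw [lapA_Hp h, lapA_Hp h, h.g_symm, adj_symm h.adj, ← Hp_apply qs g c Y, q_Hp h]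

/-- in particular ‖Δ′_a H′X‖² = ⟨(Q′G′²Q′\*)⁻¹X, X⟩. [cite: Balaban1984PropagatorsII, (2.107) p.242; Balaban1985RegularSpaces, (1.91) p.91] -/
theorem norm_lapA_Hp_sq (h : Data Δ q qs A g c) (X : F) :
    ‖lapA Δ q qs A (Hp qs g c X)‖ ^ 2 = ⟪c X, X⟫_ℝ := by
  rw [← real_inner_self_eq_norm_sq, inner_lapA_Hp_lapA_Hp h]

/-- H′ is CANONICAL: two systems of (3.25)-data over the same (Δ, Q′, Q′\*, a) give the same H′ (G′ and (Q′G′²Q′\*)⁻¹ are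
unique, `B9Thm311Data.data_g_unique`/`data_c_unique`). [cite: Balaban1985RegularSpaces, (1.91) p.91] -/
theorem Hp_indep {g' : E →ₗ[ℝ] E} {c' : F →ₗ[ℝ] F} (h : Data Δ q qs A g c) (h' : Data Δ q qs A g' c') :
    Hp qs g c = Hp qs g' c' := by
  rw [data_g_unique h h', data_c_unique h h']

end Abstract

/-! ## §2  On the lattice carriers of `B9Thm311Lattice`: H′(U₀), G′(U₀) WITH BODIES, for every background -/

section Lattice

variable {X : Type*} {Y : Type*} {V : Type*} [NormedAddCommGroup V] [InnerProductSpace ℝ V]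
variable [Fintype X] [Fintype Y] [FiniteDimensional ℝ V]
variable (τ : X → X → V →ₗ[ℝ] V) {bonds : Finset (X × X)} (cb : X × X → ℝ) {w : Y → X → ℝ}
  {B : Y → Finset X} {Γ : Y → X → List X} {y : Y → X} (a : Y → ℝ)

/-- **G′(U₀) = (Δ + Q′\*aQ′)⁻¹ of (1.91) ON THE LATTICE**, for EVERY background field with injective parallel transports
`τ x x' = R(U₀(⟨x,x'⟩))`, positive bond weights, positive averaging weights a and every block system with the printed
structural properties: the inverse of Δ′_a = `lapA (lapL τ bonds cb) (qL τ w B Γ y) Q′† (AL a)`, which is positive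
definite (`B9Thm311Lattice.lapA_lattice_posDef`, [4] Theorem 3.11). [cite: Balaban1985RegularSpaces, (1.91) p.91; Balaban1985BackgroundPropagators, (3.24) p.394, Thm 3.11 p.416] -/
def gL (hinj : ∀ x x' : X, Function.Injective (τ x x')) (hcb : ∀ b ∈ bonds, 0 < cb b)
    (hS : IsBlockSystem bonds w B Γ y) (ha : ∀ c, 0 < a c) :
    PiLp 2 (fun _ : X => V) →ₗ[ℝ] PiLp 2 (fun _ : X => V) :=
  gOf (lapL τ bonds cb) (qL τ w B Γ y) (LinearMap.adjoint (qL τ w B Γ y)) (AL a)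
    (lapA_lattice_posDef τ hinj cb hcb hS a ha)

/-- **(Q′G′²Q′\*)⁻¹ ON THE LATTICE** (exists: Q′G′²Q′\* > 0 since Q′\* is injective, [B5] p. 25 / [4] Thm 3.11).
[cite: Balaban1985RegularSpaces, (1.91) p.91; Balaban1985BackgroundPropagators, Thm 3.11 p.416; Balaban1984PropagatorsI, p.25] -/
def cL (hinj : ∀ x x' : X, Function.Injective (τ x x')) (hcb : ∀ b ∈ bonds, 0 < cb b)
    (hS : IsBlockSystem bonds w B Γ y) (ha : ∀ c, 0 < a c) :
    PiLp 2 (fun _ : Y => V) →ₗ[ℝ] PiLp 2 (fun _ : Y => V) :=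
  cOf (lapA_lattice_posDef τ hinj cb hcb hS a ha) (lapL_symm τ bonds cb) (qL_adjoint_pair τ w B Γ y) (AL_symm a)
    (adjoint_qL_injective τ hS)

/-- **H′(U₀) = G′²Q′\*(Q′G′²Q′\*)⁻¹ of (1.91) ON THE LATTICE**: a linear map L²(𝔅_k) → L²(Ω₀, 𝔤) (ℓ² carriers
`PiLp 2 (Y → V) → PiLp 2 (X → V)`), defined for every background as above. [cite: Balaban1985RegularSpaces, (1.91) p.91] -/
def HpL (hinj : ∀ x x' : X, Function.Injective (τ x x')) (hcb : ∀ b ∈ bonds, 0 < cb b)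
    (hS : IsBlockSystem bonds w B Γ y) (ha : ∀ c, 0 < a c) :
    PiLp 2 (fun _ : Y => V) →ₗ[ℝ] PiLp 2 (fun _ : X => V) :=
  Hp (LinearMap.adjoint (qL τ w B Γ y)) (gL τ cb a hinj hcb hS ha) (cL τ cb a hinj hcb hS ha)

variable {τ cb a}

/-- the lattice G′, (Q′G′²Q′\*)⁻¹ ARE (3.25)-data of [4] (two-sided inverses; Δ symmetric; Q′\* = Q′†; a symmetric).
[cite: Balaban1985BackgroundPropagators, (3.23)–(3.25) p.394, Thm 3.11 p.416] -/
theorem data_L (hinj : ∀ x x' : X, Function.Injective (τ x x')) (hcb : ∀ b ∈ bonds, 0 < cb b)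
    (hS : IsBlockSystem bonds w B Γ y) (ha : ∀ c, 0 < a c) :
    Data (lapL τ bonds cb) (qL τ w B Γ y) (LinearMap.adjoint (qL τ w B Γ y)) (AL a) (gL τ cb a hinj hcb hS ha)
      (cL τ cb a hinj hcb hS ha) :=
  data_of_posDef _ _ _ _ _

/-- G′Δ′_a = I and Δ′_aG′ = I on the lattice. [cite: Balaban1985RegularSpaces, (1.91) p.91] -/
theorem gL_lapA (hinj : ∀ x x' : X, Function.Injective (τ x x')) (hcb : ∀ b ∈ bonds, 0 < cb b)
    (hS : IsBlockSystem bonds w B Γ y) (ha : ∀ c, 0 < a c) (f : PiLp 2 (fun _ : X => V)) :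
    gL τ cb a hinj hcb hS ha (lapA (lapL τ bonds cb) (qL τ w B Γ y) (LinearMap.adjoint (qL τ w B Γ y)) (AL a) f) = f ∧
      lapA (lapL τ bonds cb) (qL τ w B Γ y) (LinearMap.adjoint (qL τ w B Γ y)) (AL a) (gL τ cb a hinj hcb hS ha f) = f :=
  ⟨(data_L hinj hcb hS ha).g_left f, (data_L hinj hcb hS ha).g_right f⟩

/-- G′(U₀) and (Q′G′²Q′\*)⁻¹ are symmetric positive definite on the lattice ([4] Theorem 3.11, "obvious for the first three
operators"). [cite: Balaban1985BackgroundPropagators, Thm 3.11 p.416] -/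
theorem gL_cL_posDef (hinj : ∀ x x' : X, Function.Injective (τ x x')) (hcb : ∀ b ∈ bonds, 0 < cb b)
    (hS : IsBlockSystem bonds w B Γ y) (ha : ∀ c, 0 < a c) :
    PosDef (gL τ cb a hinj hcb hS ha) ∧ PosDef (cL τ cb a hinj hcb hS ha) ∧
      (∀ f f' : PiLp 2 (fun _ : X => V), ⟪gL τ cb a hinj hcb hS ha f, f'⟫_ℝ = ⟪f, gL τ cb a hinj hcb hS ha f'⟫_ℝ) ∧
      (∀ φ ψ : PiLp 2 (fun _ : Y => V), ⟪cL τ cb a hinj hcb hS ha φ, ψ⟫_ℝ = ⟪φ, cL τ cb a hinj hcb hS ha ψ⟫_ℝ) := by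
  have hd := data_L hinj hcb hS ha
  exact ⟨data_g_posDef hd (lapA_lattice_posDef τ hinj cb hcb hS a ha), data_c_posDef hd (adjoint_qL_injective τ hS),
    hd.g_symm, hd.greenData.c_symm hd.lapA_symm (qL_adjoint_pair τ w B Γ y)⟩

/-- **«Q′H′ = I» ON THE LATTICE, for every background**: Q′(U₀)(H′(U₀)X) = X for every X ∈ L²(𝔅_k).
[cite: Balaban1985RegularSpaces, (1.115)–(1.116) p.96, (1.91) p.91] -/
theorem qL_HpL (hinj : ∀ x x' : X, Function.Injective (τ x x')) (hcb : ∀ b ∈ bonds, 0 < cb b)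
    (hS : IsBlockSystem bonds w B Γ y) (ha : ∀ c, 0 < a c) (Xf : PiLp 2 (fun _ : Y => V)) :
    qL τ w B Γ y (HpL τ cb a hinj hcb hS ha Xf) = Xf :=
  q_Hp (data_L hinj hcb hS ha) Xf

/-- H′(U₀)X is THE minimiser of ½‖Δ′_aλ‖² over {λ : Q′(U₀)λ = X} on the lattice (existence, minimality, uniqueness).
[cite: Balaban1984PropagatorsII, (2.101)–(2.102) p.241; Balaban1985RegularSpaces, (1.91) p.91] -/
theorem HpL_isMin (hinj : ∀ x x' : X, Function.Injective (τ x x')) (hcb : ∀ b ∈ bonds, 0 < cb b)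
    (hS : IsBlockSystem bonds w B Γ y) (ha : ∀ c, 0 < a c) (Xf : PiLp 2 (fun _ : Y => V)) :
    ∃! l : PiLp 2 (fun _ : X => V), qL τ w B Γ y l = Xf ∧
      ∀ l' : PiLp 2 (fun _ : X => V), qL τ w B Γ y l' = Xf →
        ‖lapA (lapL τ bonds cb) (qL τ w B Γ y) (LinearMap.adjoint (qL τ w B Γ y)) (AL a) l‖ ^ 2 ≤
          ‖lapA (lapL τ bonds cb) (qL τ w B Γ y) (LinearMap.adjoint (qL τ w B Γ y)) (AL a) l'‖ ^ 2 :=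
  existsUnique_minimiser (data_L hinj hcb hS ha) Xf

/-- and that minimiser is `HpL … Xf`. [cite: Balaban1984PropagatorsII, (2.101)–(2.102) p.241; Balaban1985RegularSpaces, (1.91) p.91] -/
theorem HpL_minimises (hinj : ∀ x x' : X, Function.Injective (τ x x')) (hcb : ∀ b ∈ bonds, 0 < cb b)
    (hS : IsBlockSystem bonds w B Γ y) (ha : ∀ c, 0 < a c) (Xf : PiLp 2 (fun _ : Y => V))
    (l : PiLp 2 (fun _ : X => V)) (hl : qL τ w B Γ y l = Xf) :
    ‖lapA (lapL τ bonds cb) (qL τ w B Γ y) (LinearMap.adjoint (qL τ w B Γ y)) (AL a) (HpL τ cb a hinj hcb hS ha Xf)‖ ^ 2 ≤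
      ‖lapA (lapL τ bonds cb) (qL τ w B Γ y) (LinearMap.adjoint (qL τ w B Γ y)) (AL a) l‖ ^ 2 :=
  norm_lapA_Hp_sq_le (data_L hinj hcb hS ha) Xf l hl

/-- (1.91) versus (3.25) on the lattice: the (3.22)-minimiser λ₀ = G′Rf of [4] equals G′f − H′(Q′G′f), and R is THE
orthogonal projection onto Δ^η_{U₀}N(Q′(U₀)) (`B9Eq325Proj.Data.R325_eq_starProjection_fd`).
[cite: Balaban1985BackgroundPropagators, (3.22)+(3.25) p.394; Balaban1985RegularSpaces, (1.91) p.91] -/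
theorem lam0_L (hinj : ∀ x x' : X, Function.Injective (τ x x')) (hcb : ∀ b ∈ bonds, 0 < cb b)
    (hS : IsBlockSystem bonds w B Γ y) (ha : ∀ c, 0 < a c) (f : PiLp 2 (fun _ : X => V)) :
    lam0 (qL τ w B Γ y) (LinearMap.adjoint (qL τ w B Γ y)) (gL τ cb a hinj hcb hS ha) (cL τ cb a hinj hcb hS ha) f =
        gL τ cb a hinj hcb hS ha f - HpL τ cb a hinj hcb hS ha (qL τ w B Γ y (gL τ cb a hinj hcb hS ha f)) ∧
      (lapKer (lapL τ bonds cb) (qL τ w B Γ y)).starProjection f =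
        R325 (qL τ w B Γ y) (LinearMap.adjoint (qL τ w B Γ y)) (gL τ cb a hinj hcb hS ha) (cL τ cb a hinj hcb hS ha) f :=
  ⟨lam0_eq f, (data_L hinj hcb hS ha).R325_eq_starProjection_fd f⟩

/-! ### (1.114) ⇐ (1.117) with «Q′H′ = I» DISCHARGED for the lattice H′(U₀) -/

/-- **(1.114) from (1.115)–(1.117) for the (1.91)-operator H′(U₀) on the lattice**: the abstract
`B8SectEStatements.eq1114` with its hypothesis `hQH : Q′H′ = I` DISCHARGED by `qL_HpL` — if the full averaging function
satisfies Q′(u₁, μ) = Q′μ + C′(μ) ((213) of [3]) and X solves (1.117) C′(λ − H′X) = X, then Q′(u₁, λ − H′X) = Q′λ.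
[cite: Balaban1985RegularSpaces, (1.114)–(1.117) p.95–96, (1.91) p.91] -/
theorem eq1114_L (hinj : ∀ x x' : X, Function.Injective (τ x x')) (hcb : ∀ b ∈ bonds, 0 < cb b)
    (hS : IsBlockSystem bonds w B Γ y) (ha : ∀ c, 0 < a c)
    (Qfull C' : PiLp 2 (fun _ : X => V) → PiLp 2 (fun _ : Y => V))
    (h213 : ∀ μ, Qfull μ = qL τ w B Γ y μ + C' μ) {lam : PiLp 2 (fun _ : X => V)} {Xf : PiLp 2 (fun _ : Y => V)}
    (hsol : B8SectEStatements.Eq1117 C' (LinearMap.toContinuousLinearMap (HpL τ cb a hinj hcb hS ha)) lam Xf) :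
    Qfull (lam - HpL τ cb a hinj hcb hS ha Xf) = qL τ w B Γ y lam :=
  B8SectEStatements.eq1114 Qfull (qL τ w B Γ y).toAddMonoidHom C'
    (LinearMap.toContinuousLinearMap (HpL τ cb a hinj hcb hS ha)) h213 (fun X' => qL_HpL hinj hcb hS ha X') hsol

end Lattice

/-! ## §3  The kernel form of p. 92: (H′X)(x) = Σ_{y′} H′(x, y′)X(y′) on the finite carriers -/

section Kernel

variable {X : Type*} {Y : Type*} {V : Type*} [NormedAddCommGroup V] [InnerProductSpace ℝ V]
variable [Fintype Y] [DecidableEq Y]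

/-- the KERNEL H′(x, y′) : 𝔤 → 𝔤 of a linear map T : L²(𝔅_k) → L²(Ω₀, 𝔤) on the finite carriers:
H′(x, y′)v := (T(δ_{y′}v))(x). [cite: Balaban1985RegularSpaces, p.92 (after (1.92))] -/
def kernelOf (T : PiLp 2 (fun _ : Y => V) →ₗ[ℝ] PiLp 2 (fun _ : X => V)) (x : X) (y' : Y) : V →ₗ[ℝ] V where
  toFun v := T (WithLp.toLp 2 (Pi.single y' v)) x
  map_add' v v' := by
    rw [Pi.single_add, WithLp.toLp_add, map_add, PiLp.add_apply]
  map_smul' r v := by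
    rw [Pi.single_smul, WithLp.toLp_smul, map_smul, PiLp.smul_apply, RingHom.id_apply]

/-- **p. 92: «(H′X)(x) = Σ_{y′∈𝔅_k}(L^{j′}η)^d H′(x, y′)X(y′)»** — every linear map of the finite carriers is summation
against its kernel (the coarse weights (L^{j′}η)^d of the printed formula are absorbed in the unweighted ℓ² pairing of
`B9Thm311Lattice`, cell DIVERGENCE D-b09.24). [cite: Balaban1985RegularSpaces, p.92 (after (1.92))] -/
theorem apply_eq_sum_kernelOf (T : PiLp 2 (fun _ : Y => V) →ₗ[ℝ] PiLp 2 (fun _ : X => V))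
    (Xf : PiLp 2 (fun _ : Y => V)) (x : X) :
    T Xf x = ∑ y', kernelOf T x y' (Xf y') := by
  have hX : Xf = ∑ y', WithLp.toLp 2 (Pi.single y' (Xf y')) := by
    apply PiLp.ext
    intro c
    rw [WithLp.ofLp_sum, Finset.sum_apply]
    change Xf.ofLp c = ∑ y', Pi.single y' (Xf.ofLp y') c
    rw [Finset.sum_pi_single, if_pos (Finset.mem_univ c)]
  conv_lhs => rw [hX]
  rw [map_sum, WithLp.ofLp_sum, Finset.sum_apply]
  rfl

end Kernel

end

end Literature.MathematicalPhysics.QuantumFieldTheory.Balaban1983to89.B8Eq191Hprime
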